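import Summits.AtomisticToContinuum.BoseEinsteinCondensation.Theorems.BECPhaseQuadratureSumRuleSumRuleChainGlue
import Summits.AtomisticToContinuum.BoseEinsteinCondensation.Theorems.BECConjugateDominationNearMinimiserStabilityProof
import HarnessLib

/-!
# Crux `CorrectorClosure` (stmt-AtomisticToContinuum-12058), line `volume-homotopy-sum-rule-domination` —
# registered stub `stub_densityUniformDichotomy` (S4), auxiliary file: the `(N, L)`-uniform inputs

Supports (does not close) stmt-AtomisticToContinuum-12058, route `BECInsertionCorrector`.

The engine `SumRuleChainGlue.dichotomy_of_instances` of route `BECPhaseQuadratureSumRule` (item 12627,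
proved) is stated at a general torus state of `n + 2` bodies in a box `L` with `ρ L³ = n + 2`; to run it
along the VOLUME path (fixed `N`, all `L ≥ (N/ρ₀)^{1/3}`, local density `ρ_L = N/L³ ≤ ρ₀`) one needs its
inputs in `(N, L)`-form rather than at `L = sideLength ρ N`:

* `dud_groundStateEnergy_le` — the Dyson–LSSY budget `E₀^per(v; N, L) ≤ 16πR ρ_L N` for EVERY `N ≥ 2` and
  every box `L > 4R` with `ρ_L < ρ₁(R)`, for any potential vanishing beyond `R` (hard core `2R` comparison and
  `LSSY2005_upperBound_periodic_holds`, which is already uniform in `(N, L)`);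
* `dud_density_le_of_sideLength_le` — `L ≥ sideLength ρ₀ N` means `ρ_L ≤ ρ₀` (monotonicity of the
  thresholds is the tree's `sideLength_le_sideLength`);
* `dud_condensateOccupation_eq_of_minimisers` — two exact minimisers at the same `(N, L)` have the same
  `n₀` (the proved `NearMinimiserStability`, item 11788, in both directions and `ε → 0`), so the dichotomy
  proved for the `C³` minimiser of `MinimiserRegularity` transfers to every minimiser; `dud_free_case`
  (`v(|x|) ≡ 0`: the constant state is a minimiser with `n₀ = N`);
* `dud_dichotomy_of_emptyWindow` — the ultra-dilute tail: when the infrared window is EMPTY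
  (`L Λ√(ρ_L a) < 2π`, i.e. `π L > 256 R₀ N` for `Λ²a = 1024πR₀`) no sum rule is needed: every `p ≠ 0` has
  `‖k_p‖ ≥ 2π/L`, so `Σ_{p≠0} ‖a_p a_0Ψ‖² ≤ (N-1)(L/2π)² KE ≤ (N-1) 4R₀N²/(πL) ≤ N²/64` (`uv_tail_le`),
  and `card_mul_condensateOccupation_le` + `condensateOccupation_dichotomy` (`θ = 1/32 < 3/16`) give
  `n₀ ∉ (N/4, 3N/4)`.
-/

noncomputable section

open MeasureTheory Filter Matrix
open scoped ENNReal NNReal BigOperators ComplexConjugate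

namespace Summit.AtomisticToContinuum.BoseEinsteinCondensation.Theorems.CorrectorClosure.VolumeHomotopySumRuleDomination

open Literature.MathematicalPhysics.QuantumManyBody.BoseGas
open Summit.AtomisticToContinuum.BoseEinsteinCondensation.Theorems.SumRuleChainGlue

/-! ### The uniform energy budget in `(N, L)`-form -/

/-- **Uniform energy budget of the torus ground state, `(N, L)`-form.** For every `R > 0` there is
`ρ₁ > 0` such that for every `N ≥ 2`, every box `L > 4R` with `N/L³ < ρ₁` and every potential `v` vanishing
beyond `R`: `E₀^per(v; N, L) ≤ 16πR (N/L³) N` — `E₀^per(v) ≤ E₀^per(hard core 2R) ≤ 4πρ₁a(1 + Ca/b)N`,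
`a = 2R`, `a/b ≤ min(c, 1/C)` (the `(ρ, ∀ᶠ N)`-form is `periodicEnergy_le_of_minimiser_uniform`).
[cite: LSSY2005, Thm 2.2 (2.14)] -/
theorem dud_groundStateEnergy_le {R : ℝ} (hR : 0 < R) :
    ∃ ρ₁ : ℝ, 0 < ρ₁ ∧ ∀ N : ℕ, 2 ≤ N → ∀ L : ℝ, 4 * R < L → (N : ℝ) / L ^ 3 < ρ₁ →
      ∀ v : ℝ → ℝ≥0∞, (∀ r, R < r → v r = 0) →
        periodicGroundStateEnergy v N L ≤
          ENNReal.ofReal (16 * Real.pi * R * ((N : ℝ) / L ^ 3) * N) := by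
  set w : ℝ → ℝ≥0∞ := hardCorePotential (2 * R) with hw
  have hwr : ∀ r, 2 * R < r → w r = 0 := fun r hr => hardCorePotential_of_le hr.le
  have haw : scatteringLength w = ENNReal.ofReal (2 * R) := scatteringLength_hardCorePotential _
  obtain ⟨C, c, hC, hc, H⟩ := LSSY2005_upperBound_periodic_holds w (2 * R)
    (measurable_hardCorePotential _) hwr (by rw [haw]; exact ENNReal.ofReal_ne_top)
  have ha : (scatteringLength w).toReal = 2 * R := by
    rw [haw, ENNReal.toReal_ofReal (by linarith)]
  set c' : ℝ := min c (1 / C) with hc'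
  have hc'pos : 0 < c' := lt_min hc (by positivity)
  set ρ₁ : ℝ := 3 * (c' / (2 * R)) ^ 3 / (4 * Real.pi) with hρ₁
  have hρ₁pos : 0 < ρ₁ := by positivity
  refine ⟨ρ₁, hρ₁pos, fun N hN2 L hLR hρlt v hvR => ?_⟩
  have hL : 0 < L := by linarith
  have hN0 : 0 < N := by omega
  set ρ : ℝ := (N : ℝ) / L ^ 3 with hρdef
  have hρ : 0 < ρ := by rw [hρdef]; positivity
  set ρe : ℝ := ((N : ℝ) - 1) / L ^ 3 with hρe
  have hρe_le : ρe ≤ ρ := by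
    rw [hρe, hρdef]
    exact div_le_div_of_nonneg_right (by linarith) (by positivity)
  have hρe_pos : 0 < ρe := by
    rw [hρe]
    have : (2 : ℝ) ≤ N := by exact_mod_cast hN2
    exact div_pos (by linarith) (by positivity)
  have hx_pos : 0 < 4 * Real.pi * ρe / 3 := by positivity
  have hab_eq : (2 * R) / (4 * Real.pi * ρe / 3) ^ (-(1 : ℝ) / 3) =
      2 * R * (4 * Real.pi * ρe / 3) ^ ((1 : ℝ) / 3) := by
    rw [show (-(1 : ℝ) / 3) = -(1 / 3) by norm_num, Real.rpow_neg hx_pos.le, div_inv_eq_mul]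
  have hab_lt : 2 * R * (4 * Real.pi * ρe / 3) ^ ((1 : ℝ) / 3) < c' := by
    have h1 : (4 * Real.pi * ρe / 3) ^ ((1 : ℝ) / 3) ≤ (4 * Real.pi * ρ / 3) ^ ((1 : ℝ) / 3) :=
      Real.rpow_le_rpow hx_pos.le (by gcongr) (by norm_num)
    have h2 : (4 * Real.pi * ρ / 3) ^ ((1 : ℝ) / 3) < (4 * Real.pi * ρ₁ / 3) ^ ((1 : ℝ) / 3) :=
      Real.rpow_lt_rpow (by positivity) (by gcongr) (by norm_num)
    have h3 : (4 * Real.pi * ρ₁ / 3) ^ ((1 : ℝ) / 3) = c' / (2 * R) := by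
      rw [hρ₁]
      have : 4 * Real.pi * (3 * (c' / (2 * R)) ^ 3 / (4 * Real.pi)) / 3 = (c' / (2 * R)) ^ 3 := by
        field_simp
      rw [this, show ((1 : ℝ) / 3) = ((3 : ℕ) : ℝ)⁻¹ by norm_num,
        Real.pow_rpow_inv_natCast (by positivity) three_ne_zero]
    calc 2 * R * (4 * Real.pi * ρe / 3) ^ ((1 : ℝ) / 3)
        < 2 * R * (c' / (2 * R)) := by
          apply mul_lt_mul_of_pos_left (h1.trans_lt (h2.trans_eq h3)) (by linarith)
      _ = c' := by field_simp
  have hab_c : (2 * R) / (4 * Real.pi * ρe / 3) ^ (-(1 : ℝ) / 3) ≤ c := by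
    rw [hab_eq]; exact (hab_lt.le.trans (min_le_left _ _))
  have hab_C : C * ((2 * R) / (4 * Real.pi * ρe / 3) ^ (-(1 : ℝ) / 3)) ≤ 1 := by
    rw [hab_eq]
    have h1 : 2 * R * (4 * Real.pi * ρe / 3) ^ ((1 : ℝ) / 3) ≤ 1 / C :=
      hab_lt.le.trans (min_le_right _ _)
    calc C * (2 * R * (4 * Real.pi * ρe / 3) ^ ((1 : ℝ) / 3)) ≤ C * (1 / C) :=
          mul_le_mul_of_nonneg_left h1 hC.le
      _ = 1 := by field_simp
  have hU := H N L hN2 hL (by linarith)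
  simp only at hU
  rw [ha] at hU
  have hU' := hU hab_c
  calc periodicGroundStateEnergy v N L ≤ periodicGroundStateEnergy w N L :=
        periodicGroundStateEnergy_mono_of_le (le_hardCorePotential_two_mul hR hvR)
    _ ≤ ENNReal.ofReal (4 * Real.pi * ρe * (2 * R) *
          (1 + C * ((2 * R) / (4 * Real.pi * ρe / 3) ^ (-(1 : ℝ) / 3))) * N) := hU'
    _ ≤ ENNReal.ofReal (16 * Real.pi * R * ρ * N) := by
        apply ENNReal.ofReal_le_ofReal
        have hN' : (0 : ℝ) ≤ N := N.cast_nonneg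
        have h1 : 1 + C * ((2 * R) / (4 * Real.pi * ρe / 3) ^ (-(1 : ℝ) / 3)) ≤ 2 := by linarith
        have h0 : 0 ≤ 1 + C * ((2 * R) / (4 * Real.pi * ρe / 3) ^ (-(1 : ℝ) / 3)) := by
          rw [hab_eq]; positivity
        calc 4 * Real.pi * ρe * (2 * R) * (1 + C * ((2 * R) / (4 * Real.pi * ρe / 3) ^ (-(1 : ℝ) / 3))) * N
            ≤ 4 * Real.pi * ρ * (2 * R) * 2 * N := by gcongr
          _ = 16 * Real.pi * R * ρ * N := by ring

/-! ### Side length versus local density -/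

/-- **`L ≥ sideLength ρ₀ N` means the local density `N/L³` is at most `ρ₀`.** [folklore] -/
theorem dud_density_le_of_sideLength_le {ρ₀ L : ℝ} (hρ₀ : 0 < ρ₀) {N : ℕ} (hN : 0 < N)
    (hL : sideLength ρ₀ N ≤ L) : (N : ℝ) / L ^ 3 ≤ ρ₀ := by
  have hsL : 0 < sideLength ρ₀ N := Real.rpow_pos_of_pos (div_pos (Nat.cast_pos.2 hN) hρ₀) _
  have h3 : sideLength ρ₀ N ^ 3 ≤ L ^ 3 := pow_le_pow_left₀ hsL.le hL 3
  calc (N : ℝ) / L ^ 3 ≤ (N : ℝ) / sideLength ρ₀ N ^ 3 :=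
        div_le_div_of_nonneg_left N.cast_nonneg (pow_pos hsL 3) h3
    _ = ρ₀ := div_sideLength_pow_three hρ₀ hN

/-! ### Two minimisers have the same condensate occupation -/

/-- **Two exact minimisers at the same `(N, L)` have equal condensate occupation** (smooth class): the
proved `NearMinimiserStability` (item 11788: nondegenerate torus ground state, phase alignment, `n₀`
Lipschitz) gives `n₀(Ψ) ≤ n₀(Φ) + εN` for every `ε > 0` in both directions. [folklore] -/
theorem dud_condensateOccupation_eq_of_minimisers {v : ℝ → ℝ≥0∞} (hv : IsRepulsiveFiniteRange v)
    (hfin : ∀ r, v r ≠ ⊤) (hC2 : ContDiff ℝ 2 (fun x : Space => (v ‖x‖).toReal))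
    (hedge : ∃ Cₑ : ℝ, ∀ x : Space,
      ‖iteratedFDeriv ℝ 2 (fun x : Space => (v ‖x‖).toReal) x‖ ≤ Cₑ * Real.sqrt ((v ‖x‖).toReal))
    {N : ℕ} {L : ℝ} (hL : 0 < L) (Ψ Φ : PeriodicTrialState N L)
    (hΨ : periodicEnergy v Ψ = periodicGroundStateEnergy v N L) (hΨfin : periodicEnergy v Ψ ≠ ⊤)
    (hΦ : periodicEnergy v Φ = periodicGroundStateEnergy v N L) :
    condensateOccupation N L Ψ.ψ = condensateOccupation N L Φ.ψ := by
  have hE₀ : periodicGroundStateEnergy v N L ≠ ⊤ := by rw [← hΨ]; exact hΨfin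
  -- one direction, for an ordered pair of minimisers
  have key : ∀ Ψ Φ : PeriodicTrialState N L, periodicEnergy v Ψ = periodicGroundStateEnergy v N L →
      periodicEnergy v Φ = periodicGroundStateEnergy v N L →
      condensateOccupation N L Ψ.ψ ≤ condensateOccupation N L Φ.ψ := by
    intro Ψ Φ hΨ hΦ
    refine ENNReal.le_of_forall_pos_le_add fun ε hε _ => ?_
    have hε' : 0 < (ε : ℝ) / ((N : ℝ) + 1) := div_pos (NNReal.coe_pos.2 hε) (by positivity)
    obtain ⟨δ, -, hstab⟩ := phaseQuadrature_nearMinimiserStability_proof v hv hfin hC2 hedge N L hL hE₀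
      ((ε : ℝ) / ((N : ℝ) + 1)) hε'
    have h := hstab Ψ Φ hΨ (by rw [hΦ]; exact le_self_add)
    refine h.trans (add_le_add le_rfl ?_)
    rw [← ENNReal.ofReal_coe_nnreal]
    refine ENNReal.ofReal_le_ofReal ?_
    rw [div_mul_eq_mul_div, div_le_iff₀ (by positivity)]
    exact mul_le_mul_of_nonneg_left (by linarith) (NNReal.coe_nonneg ε)
  exact le_antisymm (key Ψ Φ hΨ hΦ) (key Φ Ψ hΦ hΨ)

/-- **The free case.** If `v(|x|) ≡ 0`, the constant state is a minimiser with `n₀ = N`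
(`exists_constState`), hence every exact minimiser has `n₀ = N ≥ 3N/4`. [folklore] -/
theorem dud_free_case {v : ℝ → ℝ≥0∞} (hv : IsRepulsiveFiniteRange v)
    (hfin : ∀ r, v r ≠ ⊤) (hC2 : ContDiff ℝ 2 (fun x : Space => (v ‖x‖).toReal))
    (hedge : ∃ Cₑ : ℝ, ∀ x : Space,
      ‖iteratedFDeriv ℝ 2 (fun x : Space => (v ‖x‖).toReal) x‖ ≤ Cₑ * Real.sqrt ((v ‖x‖).toReal))
    (h0 : ∀ x : Space, v ‖x‖ = 0) {N : ℕ} {L : ℝ} (hL : 0 < L) (Ψ : PeriodicTrialState N L)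
    (hΨ : periodicEnergy v Ψ = periodicGroundStateEnergy v N L) :
    ENNReal.ofReal (3 * (N : ℝ) / 4) ≤ condensateOccupation N L Ψ.ψ := by
  obtain ⟨Ψc, hEc0, hn0⟩ := exists_constState hL N
  have hEc : periodicEnergy v Ψc = 0 := by rw [periodicEnergy_eq_zero_pot h0, hEc0]
  have hGS : periodicGroundStateEnergy v N L = 0 :=
    le_antisymm ((periodicGroundStateEnergy_le v Ψc).trans hEc.le) bot_le
  have heq := dud_condensateOccupation_eq_of_minimisers hv hfin hC2 hedge hL Ψc Ψ (by rw [hEc, hGS])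
    (by rw [hEc]; exact ENNReal.zero_ne_top) hΨ
  rw [← heq, hn0, ← ENNReal.ofReal_natCast]
  exact ENNReal.ofReal_le_ofReal (by linarith [N.cast_nonneg (α := ℝ)])

/-! ### The empty infrared window (ultra-dilute tail) -/

/-- For `p ≠ 0` the wave vector is not shorter than the lattice spacing: `2π/L ≤ ‖k_p‖`. [folklore] -/
theorem dud_two_pi_div_le_norm_kvec {L : ℝ} (hL : 0 < L) {p : Fin 3 → ℤ} (hp : p ≠ 0) :
    2 * Real.pi / L ≤ ‖kvec L p‖ := by
  have h1 : (1 : ℝ) ≤ ‖latticeVec 1 p‖ := by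
    have h := supNorm_le_norm_latticeVec p
    have h1 : (1 : ℝ) ≤ ((Finset.univ.sup fun j => (p j).natAbs : ℕ) : ℝ) := by
      exact_mod_cast one_le_supNorm_of_ne_zero hp
    exact h1.trans h
  show 2 * Real.pi / L ≤ ‖(2 * Real.pi / L) • latticeVec 1 p‖
  rw [norm_kvec_eq hL]
  exact le_mul_of_one_le_right (by positivity) h1

/-- **The dichotomy on the ultra-dilute tail (empty infrared window).** For a torus state `Ψ` of
`n + 2` bosons in a box `L` with `ρ L³ = n + 2`, energy `≤ 16πR₀ρN`, `Λ²a = 1024πR₀` and EMPTY window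
`L Λ√(ρa) < 2π` (so `πL > 256R₀N`): `Σ_{p≠0} ‖a_p a_0Ψ‖² ≤ (N-1)(L/2π)²·KE ≤ N²/64` (`uv_tail_le` at
`K₀ = 2π/L`, every `p ≠ 0` is in the tail), and with the instance of `CondensateNumberConcentration`
(`ζ = 1/64`) the dichotomy `n₀ ≤ N/4 ∨ 3N/4 ≤ n₀` follows (`θ = 1/32 < 3/16`). [folklore] -/
theorem dud_dichotomy_of_emptyWindow {n : ℕ} {L : ℝ} {v : ℝ → ℝ≥0∞} {R₀ Λ a ρ : ℝ} (hL : 0 < L)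
    (hR₀ : 0 < R₀) (ha : 0 < a) (hΛ : 0 < Λ) (hΛ2 : Λ ^ 2 * a = 1024 * Real.pi * R₀) (hρ : 0 < ρ)
    (hρL : ρ * L ^ 3 = (n + 2 : ℕ)) (hM : L * (Λ * Real.sqrt (ρ * a)) / (2 * Real.pi) < 1)
    (Ψ : PeriodicTrialState (n + 2) L)
    (hE : periodicEnergy v Ψ ≤ ENNReal.ofReal (16 * Real.pi * R₀ * ρ * ((n + 2 : ℕ) : ℝ)))
    (hV : ((n + 2 : ℕ) : ℝ≥0∞) * ((n + 1 : ℕ) : ℝ≥0∞) * (∫⁻ Y in cellN n L,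
        (‖∫ x in cell L, ∫ y in cell L,
          Ψ.ψ (Matrix.vecCons x (Matrix.vecCons y Y))‖₊ : ℝ≥0∞) ^ 2) / ENNReal.ofReal (L ^ 6) +
        condensateOccupation (n + 2) L Ψ.ψ ≤
      condensateOccupation (n + 2) L Ψ.ψ ^ 2 + ENNReal.ofReal (1 / 64 * ((n : ℝ) + 2) ^ 2)) :
    condensateOccupation (n + 2) L Ψ.ψ ≤ ENNReal.ofReal (((n + 2 : ℕ) : ℝ) / 4) ∨
      ENNReal.ofReal (3 * ((n + 2 : ℕ) : ℝ) / 4) ≤ condensateOccupation (n + 2) L Ψ.ψ := by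
  set N : ℝ := ((n + 2 : ℕ) : ℝ) with hN
  have hNpos : 0 < N := by rw [hN]; positivity
  have hK : 0 < 2 * Real.pi / L := by positivity
  -- every `p ≠ 0` lies in the ultraviolet tail `‖k_p‖ ≥ 2π/L`
  have hT1 : ∑' p : Fin 3 → ℤ, (if p = 0 then 0 else pairOcc L p Ψ.ψ) ≤
      ∑' p : Fin 3 → ℤ, {p : Fin 3 → ℤ | 2 * Real.pi / L ≤ ‖kvec L p‖}.indicator
        (fun p => pairOcc L p Ψ.ψ) p := by
    refine ENNReal.tsum_le_tsum fun p => ?_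
    by_cases hp : p = 0
    · rw [if_pos hp]; exact bot_le
    · rw [if_neg hp, Set.indicator_of_mem (show p ∈ {p : Fin 3 → ℤ | 2 * Real.pi / L ≤ ‖kvec L p‖} from
        dud_two_pi_div_le_norm_kvec hL hp)]
  have hT2 := uv_tail_le hL Ψ hK
  have hkin : ∫⁻ X in cellN (n + 2) L, kineticDensity Ψ.ψ X ≤
      ENNReal.ofReal (16 * Real.pi * R₀ * ρ * N) :=
    (lintegral_kineticDensity_le_periodicEnergy v Ψ).trans hE
  -- the empty window: `256 R₀ N < π L`
  have hLlow : 256 * R₀ * N < Real.pi * L := by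
    have h1 : L * (Λ * Real.sqrt (ρ * a)) < 2 * Real.pi := by
      rwa [div_lt_one (by positivity)] at hM
    have h0 : 0 ≤ L * (Λ * Real.sqrt (ρ * a)) := by positivity
    have h2 : (L * (Λ * Real.sqrt (ρ * a))) ^ 2 < (2 * Real.pi) ^ 2 :=
      pow_lt_pow_left₀ h1 h0 two_ne_zero
    have h3 : (L * (Λ * Real.sqrt (ρ * a))) ^ 2 = L ^ 2 * (Λ ^ 2 * a) * ρ := by
      rw [mul_pow, mul_pow, Real.sq_sqrt (by positivity)]; ring
    rw [h3, hΛ2] at h2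
    have h4 : L ^ 2 * (1024 * Real.pi * R₀) * ρ = 1024 * Real.pi * R₀ * N / L := by
      rw [← hρL]; field_simp
    rw [h4, div_lt_iff₀ hL] at h2
    nlinarith [Real.pi_pos]
  -- the real arithmetic `(N-1) (L/2π)² 16πR₀ρN ≤ N²/64`
  have hK2 : ((2 * Real.pi / L) ^ 2)⁻¹ * (16 * Real.pi * R₀ * ρ * N) = 4 * R₀ * N ^ 2 / (Real.pi * L) := by
    have hρ' : ρ = N / L ^ 3 := by rw [← hρL]; field_simp
    rw [hρ']
    field_simp
    ring
  have hn1 : ((n + 1 : ℕ) : ℝ) ≤ N := by rw [hN]; push_cast; linarith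
  have hreal : ((n + 1 : ℕ) : ℝ) * (((2 * Real.pi / L) ^ 2)⁻¹ * (16 * Real.pi * R₀ * ρ * N)) ≤
      1 / 64 * N ^ 2 := by
    rw [hK2, mul_div_assoc', div_le_iff₀ (by positivity)]
    have h7 : 256 * R₀ * ((n + 1 : ℕ) : ℝ) ≤ Real.pi * L := by nlinarith
    calc ((n + 1 : ℕ) : ℝ) * (4 * R₀ * N ^ 2) = (256 * R₀ * ((n + 1 : ℕ) : ℝ)) * N ^ 2 / 64 := by ring
      _ ≤ (Real.pi * L) * N ^ 2 / 64 := by gcongr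
      _ = 1 / 64 * N ^ 2 * (Real.pi * L) := by ring
  have hmodes : ∑' p : Fin 3 → ℤ, (if p = 0 then 0 else pairOcc L p Ψ.ψ) ≤
      ENNReal.ofReal (1 / 64 * N ^ 2) := by
    refine (hT1.trans hT2).trans ?_
    calc ((n + 1 : ℕ) : ℝ≥0∞) * ENNReal.ofReal (((2 * Real.pi / L) ^ 2)⁻¹) *
          ∫⁻ X in cellN (n + 2) L, kineticDensity Ψ.ψ X
        ≤ ((n + 1 : ℕ) : ℝ≥0∞) * ENNReal.ofReal (((2 * Real.pi / L) ^ 2)⁻¹) *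
          ENNReal.ofReal (16 * Real.pi * R₀ * ρ * N) := by gcongr
      _ = ENNReal.ofReal (((n + 1 : ℕ) : ℝ) * (((2 * Real.pi / L) ^ 2)⁻¹ * (16 * Real.pi * R₀ * ρ * N))) := by
          rw [← ENNReal.ofReal_natCast, ← ENNReal.ofReal_mul (Nat.cast_nonneg _),
            ← ENNReal.ofReal_mul (p := ((n + 1 : ℕ) : ℝ) * ((2 * Real.pi / L) ^ 2)⁻¹) (by positivity),
            mul_assoc]
      _ ≤ ENNReal.ofReal (1 / 64 * N ^ 2) := ENNReal.ofReal_le_ofReal hreal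
  have hmain := card_mul_condensateOccupation_le hL Ψ (by norm_num : (0 : ℝ) ≤ 1 / 64)
    (by norm_num : (0 : ℝ) ≤ 1 / 64) hV hmodes
  exact condensateOccupation_dichotomy hL Ψ (by norm_num) (by norm_num) hmain

end Summit.AtomisticToContinuum.BoseEinsteinCondensation.Theorems.CorrectorClosure.VolumeHomotopySumRuleDomination

end
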